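import Mathlib
import Summits.ValiantsHypothesis.ValiantsHypothesis.Theorems.LacunarySymmetroidMatrixDescartesCensusRealExponentsAllSizesLocus
import Summits.ValiantsHypothesis.ValiantsHypothesis.Theorems.LacunarySymmetroidMatrixDescartesCensusSupportNormalForm

/-!
# `MatrixDescartes` (stmt-ValiantsHypothesis-18050) — DENSE TRANSFER of a positive-root law:
# a bound on the distinct (or multiplicity-counted) positive det-roots on a family of pencils whose closure contains
# every symmetric pencil of the format is a bound for EVERY symmetric pencil of the format — no loss of constant

Helper file (`--supports stmt-ValiantsHypothesis-18050 --as helper`; cell val-lit, seat val-port-3 g1, merged desk g12;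
input: val-lit-p8 g12's audit `NOTE-p8g12-18050-stub_recursion-inputs-audit.md` §1 R6(b) of line
`Cruxes/MatrixDescartes/Lines/osculation_law.lean`, stub `stub_recursion`).  Closes NO item.

The recursion of the osculation-law line runs on pencils in GENERAL POSITION (a format-open, conjecturally dense
class) and in the MULTIPLICITY currency, while the target `PosRootLawAt m K B` (hence `PosKPlusLogSqLaw`) quantifies
over EVERY symmetric pencil in the DISTINCT currency.  The audit (§1 R6(b)) isolates the transfer between the two as
a step needing a DIRECTED perturbation (a positive root of even multiplicity can disappear under an undirected one).
The tree already holds that perturbation theory: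
`Census.RealExp.exists_brackets_of_le_card_posRoots_symm` (`…CensusRealExponentsAllSizesLocus`: `N` distinct
positive det-roots of a symmetric pencil on an integer support `d` ⇒ a symmetric pencil on the SAME support whose
determinant changes sign across `N` pairwise disjoint positive brackets) — and sign-change brackets are OPEN
conditions in the letters.  This file supplies the glue and the transfer theorems:

* `continuous_det_pencilAt` — `S ↦ det (∑_l a^{d_l} S_l)` is continuous in the letters;
* `brackets_persist` — finitely many strict sign-change brackets of `det F_S` persist on a neighbourhood of `S`;
* `le_card_posRoots_of_brackets` — `n` pairwise disjoint positive sign-change brackets ⇒ at least `n` distinct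
  positive roots (IVT; the bracket twin of `SymmetroidDescartes.le_card_posRoots_of_alternating`);
* `pencil_reindex`, `det_pencil_reindex`, `isSymm_reindex` — block-indexed pencils (`Fin r ⊕ Fin s`, the line's
  format) versus `Fin m`: reindexing the letters does not change the determinant;
* **`posRootLawAt_of_frequently`** — if near EVERY symmetric pencil `S` of the format there are, arbitrarily close,
  pencils `S'` (not necessarily symmetric) with at most `B` distinct positive det-roots, then `PosRootLawAt m K B`;
* **`posRootLawAt_of_dense`** — the law with bound `B` on any family `G d` of pencils whose closure contains the
  symmetric pencils on `d`, for every support `d`, gives `PosRootLawAt m K B` (SAME `B`);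
* **`posRootLawAt_of_dense_mult`** — the same from the MULTIPLICITY count
  `Multiset.card (det.roots.filter (0 < ·)) ≤ B` on the dense family (the line's `posRootsMult` currency);
* `posRootLawAt_of_forall_exists_near` / `…_mult` — the same with density spelled entrywise (`ε`-close letters);
* `card_posRoots_le_of_frequently`, `card_posRoots_le_of_dense_mult(_reindex)` — the same statements ONE SUPPORT
  `d` at a time (the cores; density and the bound are used on the same support only);
* `posRootLawAt_of_dense_mult_reindex` — the multiplicity form for families of `ι`-indexed pencils, `ι ≃ Fin m`
  (the recursion runs on `Fin m ⊕ Fin 0`; reindex once, here);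
* **`posRootLawAt_of_dense_mult_reindex_strictMono`** / `posRootLawAt_of_dense_mult_strictMono` — CONSUMER FORM:
  density and the multiplicity bound asked only on supports in normal form (`d` strictly increasing, `d 0 = 0`;
  tree `Census.posRootLawAt_iff_strictMono`), since on supports with repeated exponents a general-position class
  need not be dense; `posRootLawAt_zero_letters` (`K = 0`).

So the transfer half of `stub_recursion` costs exactly the DENSITY of the general-position class (audit R6(a)); the
currency change and the passage to all pencils are free.  [folklore] IVT and continuity of `det`.

Honest framing: helper toward an OPEN stub of a LAW line; `stub_recursion`, the osculation LAW, `MatrixDescartes`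
(18050), Conjecture B and VP ≠ VNP are NOT proved here and are not claimed.
-/

-- `Summit.ValiantsHypothesis.ValiantsHypothesis.…` repeats a component by the D-0017 layout (single-conjunct summit).
set_option linter.dupNamespace false

namespace Summit.ValiantsHypothesis.ValiantsHypothesis.Theorems.LacunarySymmetroidMatrixDescartes.DenseTransfer

open Polynomial Matrix Filter Topology
open scoped BigOperators
open Summit.ValiantsHypothesis.ValiantsHypothesis.Theorems.MatrixDescartes.Negative (PosRootLawAt)
open Summit.ValiantsHypothesis.ValiantsHypothesis.Theorems.SymmetroidDescartes (eval_det_pencil)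

variable {m K : ℕ}

/-! ## Continuity in the letters and persistence of brackets -/

/-- The determinant of the evaluated pencil `∑_l a^{d_l} • S_l` is a continuous function of the letters `S`.
[folklore] -/
theorem continuous_det_pencilAt (d : Fin K → ℕ) (a : ℝ) :
    Continuous fun S : Fin K → Matrix (Fin m) (Fin m) ℝ => (∑ l, a ^ d l • S l).det := by
  have h : ∀ l : Fin K, Continuous fun S : Fin K → Matrix (Fin m) (Fin m) ℝ => a ^ d l • S l :=
    fun l => (continuous_apply l).const_smul (a ^ d l)
  exact (continuous_finsetSum Finset.univ fun l _ => h l).matrix_det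

/-- The product `det F_S(a) · det F_S(b)` of two evaluations of the pencil determinant is continuous in the
letters. [folklore] -/
theorem continuous_eval_mul_eval (d : Fin K → ℕ) (a b : ℝ) :
    Continuous fun S : Fin K → Matrix (Fin m) (Fin m) ℝ =>
      ((∑ l, (X : ℝ[X]) ^ d l • (S l).map C).det.eval a) *
        ((∑ l, (X : ℝ[X]) ^ d l • (S l).map C).det.eval b) := by
  simp only [eval_det_pencil]
  exact (continuous_det_pencilAt d a).mul (continuous_det_pencilAt d b)

/-- **Sign-change brackets persist.**  If the determinant of the pencil on the letters `S` changes sign strictly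
across each of finitely many brackets `(a_i, b_i)`, then so does the determinant of every pencil on letters close
enough to `S` (same support). [folklore] -/
theorem brackets_persist {n : ℕ} (d : Fin K → ℕ) (S : Fin K → Matrix (Fin m) (Fin m) ℝ) (a b : Fin n → ℝ)
    (hsign : ∀ i, ((∑ l, (X : ℝ[X]) ^ d l • (S l).map C).det.eval (a i)) *
      ((∑ l, (X : ℝ[X]) ^ d l • (S l).map C).det.eval (b i)) < 0) :
    ∀ᶠ S' in 𝓝 S, ∀ i, ((∑ l, (X : ℝ[X]) ^ d l • (S' l).map C).det.eval (a i)) *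
      ((∑ l, (X : ℝ[X]) ^ d l • (S' l).map C).det.eval (b i)) < 0 := by
  rw [Filter.eventually_all]
  intro i
  exact (continuous_eval_mul_eval d (a i) (b i)).continuousAt.eventually_lt continuousAt_const (hsign i)

/-! ## Brackets give distinct roots -/

/-- **Disjoint positive sign-change brackets give distinct positive roots.**  If a real polynomial `p` satisfies
`p(a_i) · p(b_i) < 0` across `n` brackets `0 < a_i < b_i` with `b_i ≤ a_j` for `i < j`, then `p` has at least `n`
distinct positive roots (one inside each bracket, by the intermediate value theorem). [folklore] -/
theorem le_card_posRoots_of_brackets (p : ℝ[X]) {n : ℕ} (a b : Fin n → ℝ) (ha : ∀ i, 0 < a i)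
    (hab : ∀ i, a i < b i) (hdisj : ∀ i j, i < j → b i ≤ a j)
    (hsign : ∀ i, p.eval (a i) * p.eval (b i) < 0) :
    n ≤ (p.roots.toFinset.filter (fun t => 0 < t)).card := by
  classical
  have hroot : ∀ i : Fin n, ∃ r, a i < r ∧ r < b i ∧ p.IsRoot r := by
    intro i
    have hcont : ContinuousOn (fun x => p.eval x) (Set.Icc (a i) (b i)) := p.continuous.continuousOn
    rcases mul_neg_iff.1 (hsign i) with ⟨h1, h2⟩ | ⟨h1, h2⟩
    · obtain ⟨r, ⟨hr1, hr2⟩, hr⟩ := intermediate_value_Ioo' (hab i).le hcont ⟨h2, h1⟩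
      exact ⟨r, hr1, hr2, hr⟩
    · obtain ⟨r, ⟨hr1, hr2⟩, hr⟩ := intermediate_value_Ioo (hab i).le hcont ⟨h1, h2⟩
      exact ⟨r, hr1, hr2, hr⟩
  choose r hr₁ hr₂ hr₃ using hroot
  have hmono : StrictMono r := by
    intro i j hij
    calc r i < b i := hr₂ i
      _ ≤ a j := hdisj i j hij
      _ < r j := hr₁ j
  rcases Nat.eq_zero_or_pos n with hn | hn
  · omega
  have hp : p ≠ 0 := by
    rintro rfl
    exact (lt_irrefl (0 : ℝ)) (by simpa using hsign ⟨0, hn⟩)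
  calc n = (Finset.univ : Finset (Fin n)).card := by simp
    _ ≤ (p.roots.toFinset.filter (fun t => 0 < t)).card := by
      refine Finset.card_le_card_of_injOn r (fun j _ => ?_) hmono.injective.injOn
      simp only [Finset.mem_coe, Finset.mem_filter, Multiset.mem_toFinset, Polynomial.mem_roots hp]
      exact ⟨hr₃ j, (ha j).trans (hr₁ j)⟩

/-! ## Reindexing (block pencils `Fin r ⊕ Fin s` versus `Fin m`) -/

/-- Reindexing every letter along one equivalence of the index type reindexes the pencil. -/
theorem pencil_reindex {n n' : Type*} [Fintype n] [DecidableEq n] [Fintype n'] [DecidableEq n']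
    (e : n ≃ n') (d : Fin K → ℕ) (S : Fin K → Matrix n n ℝ) :
    (∑ l, (X : ℝ[X]) ^ d l • (Matrix.reindex e e (S l)).map C) =
      Matrix.reindex e e (∑ l, (X : ℝ[X]) ^ d l • (S l).map C) := by
  ext i j
  simp [Matrix.sum_apply]

/-- Reindexing every letter along one equivalence of the index type does not change the pencil determinant (so
neither its positive roots, in either currency): the law may be checked on block-indexed pencils `Fin r ⊕ Fin s`,
`r + s = m`, and transported to `Fin m`. [folklore] -/
theorem det_pencil_reindex {n n' : Type*} [Fintype n] [DecidableEq n] [Fintype n'] [DecidableEq n']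
    (e : n ≃ n') (d : Fin K → ℕ) (S : Fin K → Matrix n n ℝ) :
    (∑ l, (X : ℝ[X]) ^ d l • (Matrix.reindex e e (S l)).map C).det =
      (∑ l, (X : ℝ[X]) ^ d l • (S l).map C).det := by
  rw [pencil_reindex, Matrix.det_reindex_self]

/-- Symmetry of the letters is preserved by reindexing along one equivalence. -/
theorem isSymm_reindex {n n' : Type*} (e : n ≃ n') {A : Matrix n n ℝ} (hA : A.IsSymm) :
    (Matrix.reindex e e A).IsSymm := by
  unfold Matrix.IsSymm at hA ⊢
  rw [Matrix.transpose_reindex, hA]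

/-! ## The transfer theorems -/

/-- **Dense transfer on ONE support, `frequently` form (the core).**  Fix a support `d`.  If arbitrarily close to EVERY
symmetric `m × m` letter family `S` there are letter families `S'` (any real letters) whose pencil on `d` has at most `B`
distinct positive det-roots, then every symmetric pencil on `d` has at most `B` distinct positive det-roots.
Proof: `B + 1` distinct positive roots of `det F_S` give (tree: `Census.RealExp.exists_brackets_of_le_card_posRoots_symm`)
a symmetric pencil `S₁` on the SAME support with `≥ B + 1` pairwise disjoint positive sign-change brackets; these
persist near `S₁` (`brackets_persist`), so a nearby pencil with `≤ B` distinct positive roots would have `≥ B + 1`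
of them (`le_card_posRoots_of_brackets`). [folklore] -/
theorem card_posRoots_le_of_frequently {B : ℕ} (d : Fin K → ℕ)
    (h : ∀ (S : Fin K → Matrix (Fin m) (Fin m) ℝ), (∀ l, (S l).IsSymm) →
      ∃ᶠ S' in 𝓝 S,
        ((∑ l, (X : ℝ[X]) ^ d l • (S' l).map C).det.roots.toFinset.filter (fun t => 0 < t)).card ≤ B)
    (S : Fin K → Matrix (Fin m) (Fin m) ℝ) (hS : ∀ l, (S l).IsSymm) :
    ((∑ l, (X : ℝ[X]) ^ d l • (S l).map C).det.roots.toFinset.filter (fun t => 0 < t)).card ≤ B := by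
  classical
  rcases Nat.eq_zero_or_pos K with hK | hK
  · subst hK
    rw [SymmetroidDescartes.card_filter_roots_det_sum_fin_zero]
    exact Nat.zero_le _
  obtain ⟨k, rfl⟩ : ∃ k, K = k + 1 := ⟨K - 1, by omega⟩
  by_contra hlt
  push Not at hlt
  obtain ⟨S₁, hS₁, n, hn, a, b, ha, hab, hdisj, hsign⟩ :=
    Census.RealExp.exists_brackets_of_le_card_posRoots_symm d S hS (Nat.succ_pos B) (Nat.succ_le_of_lt hlt)
  obtain ⟨S', hS'B, hS'sign⟩ := ((h S₁ hS₁).and_eventually (brackets_persist d S₁ a b hsign)).exists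
  have hle := le_card_posRoots_of_brackets _ a b ha hab hdisj hS'sign
  omega

/-- **Dense transfer, `frequently` form.**  If arbitrarily close to EVERY symmetric `m × m` pencil with `K` letters
on every support `d` there are pencils (any real letters) whose determinant has at most `B` distinct positive roots,
then every symmetric `(m, K)` pencil has at most `B` distinct positive det-roots: `PosRootLawAt m K B`. [folklore] -/
theorem posRootLawAt_of_frequently {B : ℕ}
    (h : ∀ (d : Fin K → ℕ) (S : Fin K → Matrix (Fin m) (Fin m) ℝ), (∀ l, (S l).IsSymm) →
      ∃ᶠ S' in 𝓝 S,
        ((∑ l, (X : ℝ[X]) ^ d l • (S' l).map C).det.roots.toFinset.filter (fun t => 0 < t)).card ≤ B) :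
    PosRootLawAt m K B :=
  fun d S hS => card_posRoots_le_of_frequently d (h d) S hS

/-- **Dense transfer on one support, family form, MULTIPLICITY currency.**  Fix a support `d` and a family `G` of
letter families whose closure contains every symmetric letter family.  If every pencil on `d` with letters in `G`
has at most `B` positive det-roots counted with multiplicity, then every symmetric pencil on `d` has at most `B`
distinct positive det-roots. [folklore] -/
theorem card_posRoots_le_of_dense_mult {B : ℕ} (d : Fin K → ℕ) (G : Set (Fin K → Matrix (Fin m) (Fin m) ℝ))
    (hG : ∀ (S : Fin K → Matrix (Fin m) (Fin m) ℝ), (∀ l, (S l).IsSymm) → S ∈ closure G)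
    (hB : ∀ S' ∈ G, Multiset.card (((∑ l, (X : ℝ[X]) ^ d l • (S' l).map C).det.roots.filter (fun t => 0 < t))) ≤ B)
    (S : Fin K → Matrix (Fin m) (Fin m) ℝ) (hS : ∀ l, (S l).IsSymm) :
    ((∑ l, (X : ℝ[X]) ^ d l • (S l).map C).det.roots.toFinset.filter (fun t => 0 < t)).card ≤ B := by
  classical
  refine card_posRoots_le_of_frequently d (fun T hT => ?_) S hS
  refine (mem_closure_iff_frequently.mp (hG T hT)).mono fun S' hS' => ?_
  calc ((∑ l, (X : ℝ[X]) ^ d l • (S' l).map C).det.roots.toFinset.filter (fun t => 0 < t)).card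
      ≤ Multiset.card (((∑ l, (X : ℝ[X]) ^ d l • (S' l).map C).det.roots.filter (fun t => 0 < t))) := by
        rw [← Multiset.toFinset_filter]; exact Multiset.toFinset_card_le _
    _ ≤ B := hB S' hS'

/-- **Dense transfer, family form.**  Let `G d` be, for every support `d`, a family of `m × m` pencils with `K`
letters whose CLOSURE contains every symmetric pencil on `d` (e.g. a dense general-position class).  If every pencil
of `G d` has at most `B` distinct positive det-roots, then `PosRootLawAt m K B` — the same `B`, every symmetric
pencil. [folklore] -/
theorem posRootLawAt_of_dense {B : ℕ} (G : (Fin K → ℕ) → Set (Fin K → Matrix (Fin m) (Fin m) ℝ))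
    (hG : ∀ (d : Fin K → ℕ) (S : Fin K → Matrix (Fin m) (Fin m) ℝ), (∀ l, (S l).IsSymm) → S ∈ closure (G d))
    (hB : ∀ (d : Fin K → ℕ), ∀ S' ∈ G d,
      ((∑ l, (X : ℝ[X]) ^ d l • (S' l).map C).det.roots.toFinset.filter (fun t => 0 < t)).card ≤ B) :
    PosRootLawAt m K B :=
  posRootLawAt_of_frequently fun d S hS =>
    (mem_closure_iff_frequently.mp (hG d S hS)).mono fun S' hS' => hB d S' hS'

/-- The distinct positive-root count is at most the multiplicity-counted one (the line's `posRootsMult`). -/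
theorem card_posRoots_le_card_filter_roots (p : ℝ[X]) :
    (p.roots.toFinset.filter (fun t => 0 < t)).card ≤ Multiset.card (p.roots.filter (fun t => 0 < t)) := by
  classical
  rw [← Multiset.toFinset_filter]
  exact Multiset.toFinset_card_le _

/-- **Dense transfer, family form, MULTIPLICITY currency.**  If every pencil of a family `G d` whose closure
contains the symmetric pencils on `d` has at most `B` positive det-roots COUNTED WITH MULTIPLICITY
(`Multiset.card (det.roots.filter (0 < ·)) ≤ B`, the zero polynomial counting `0`), then `PosRootLawAt m K B`.
[folklore] -/
theorem posRootLawAt_of_dense_mult {B : ℕ} (G : (Fin K → ℕ) → Set (Fin K → Matrix (Fin m) (Fin m) ℝ))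
    (hG : ∀ (d : Fin K → ℕ) (S : Fin K → Matrix (Fin m) (Fin m) ℝ), (∀ l, (S l).IsSymm) → S ∈ closure (G d))
    (hB : ∀ (d : Fin K → ℕ), ∀ S' ∈ G d,
      Multiset.card (((∑ l, (X : ℝ[X]) ^ d l • (S' l).map C).det.roots.filter (fun t => 0 < t))) ≤ B) :
    PosRootLawAt m K B :=
  posRootLawAt_of_dense G hG fun d S' hS' => (card_posRoots_le_card_filter_roots _).trans (hB d S' hS')

/-! ## Entrywise (`ε`) spelling of density -/

/-- A neighbourhood of a letter family contains an entrywise `ε`-box. [folklore] -/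
theorem exists_box_subset_of_mem_nhds (S : Fin K → Matrix (Fin m) (Fin m) ℝ)
    {U : Set (Fin K → Matrix (Fin m) (Fin m) ℝ)} (hU : U ∈ 𝓝 S) :
    ∃ ε > 0, ∀ S' : Fin K → Matrix (Fin m) (Fin m) ℝ, (∀ l i j, |S' l i j - S l i j| < ε) → S' ∈ U := by
  -- the topology of `Matrix` is (definitionally) the product topology, so we may work in the metric space
  -- `Fin K → Fin m → Fin m → ℝ` (sup distance) and transport along the definitional equality
  have key : ∀ (T : Fin K → Fin m → Fin m → ℝ) (V : Set (Fin K → Fin m → Fin m → ℝ)), V ∈ 𝓝 T →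
      ∃ ε > 0, ∀ T' : Fin K → Fin m → Fin m → ℝ, (∀ l i j, |T' l i j - T l i j| < ε) → T' ∈ V := by
    intro T V hV
    obtain ⟨ε, hε, hball⟩ := Metric.mem_nhds_iff.mp hV
    refine ⟨ε, hε, fun T' hT' => hball ?_⟩
    rw [Metric.mem_ball, dist_pi_lt_iff hε]
    intro l
    rw [dist_pi_lt_iff hε]
    intro i
    rw [dist_pi_lt_iff hε]
    intro j
    rw [Real.dist_eq]
    exact hT' l i j
  exact key S U hU

/-- **Dense transfer, `ε` form.**  If for every symmetric pencil `S` on every support `d` and every `ε > 0` there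
is a pencil `S'` with letters entrywise `ε`-close to those of `S` and at most `B` distinct positive det-roots, then
`PosRootLawAt m K B`. [folklore] -/
theorem posRootLawAt_of_forall_exists_near {B : ℕ}
    (h : ∀ (d : Fin K → ℕ) (S : Fin K → Matrix (Fin m) (Fin m) ℝ), (∀ l, (S l).IsSymm) → ∀ ε > 0,
      ∃ S' : Fin K → Matrix (Fin m) (Fin m) ℝ, (∀ l i j, |S' l i j - S l i j| < ε) ∧
        ((∑ l, (X : ℝ[X]) ^ d l • (S' l).map C).det.roots.toFinset.filter (fun t => 0 < t)).card ≤ B) :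
    PosRootLawAt m K B := by
  refine posRootLawAt_of_frequently fun d S hS => ?_
  rw [Filter.frequently_iff]
  intro U hU
  obtain ⟨ε, hε, hbox⟩ := exists_box_subset_of_mem_nhds S hU
  obtain ⟨S', hS', hB⟩ := h d S hS ε hε
  exact ⟨S', hbox S' hS', hB⟩

/-- **Dense transfer, `ε` form, MULTIPLICITY currency.** [folklore] -/
theorem posRootLawAt_of_forall_exists_near_mult {B : ℕ}
    (h : ∀ (d : Fin K → ℕ) (S : Fin K → Matrix (Fin m) (Fin m) ℝ), (∀ l, (S l).IsSymm) → ∀ ε > 0,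
      ∃ S' : Fin K → Matrix (Fin m) (Fin m) ℝ, (∀ l i j, |S' l i j - S l i j| < ε) ∧
        Multiset.card (((∑ l, (X : ℝ[X]) ^ d l • (S' l).map C).det.roots.filter (fun t => 0 < t))) ≤ B) :
    PosRootLawAt m K B :=
  posRootLawAt_of_forall_exists_near fun d S hS ε hε => by
    obtain ⟨S', hS', hB⟩ := h d S hS ε hε
    exact ⟨S', hS', (card_posRoots_le_card_filter_roots _).trans hB⟩

/-! ## The transfer on a reindexed format (`Fin m ⊕ Fin 0`, or any `ι ≃ Fin m`) -/

/-- Reindexing all letters along `e : ι ≃ ι'` is a continuous map of letter families. -/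
theorem continuous_reindex_letters {ι ι' : Type*} [Fintype ι] [Fintype ι'] (e : ι ≃ ι') :
    Continuous fun S : Fin K → Matrix ι ι ℝ => fun l => Matrix.reindex e e (S l) :=
  continuous_pi fun l => (continuous_apply l).matrix_submatrix e.symm e.symm

/-- **Dense transfer on one support, MULTIPLICITY currency, on any index type `ι ≃ Fin m`** (the recursion of the
osculation-law line runs on `Fin m ⊕ Fin 0`).  Fix a support `d` and a family `G` of `ι`-indexed letter families
with every SYMMETRIC `ι`-indexed letter family in its closure; if every pencil on `d` with letters in `G` has at most
`B` positive det-roots counted with multiplicity, then every symmetric `Fin m`-indexed pencil on `d` has at most `B`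
distinct positive det-roots. [folklore] -/
theorem card_posRoots_le_of_dense_mult_reindex {B : ℕ} {ι : Type*} [Fintype ι] [DecidableEq ι] (e : ι ≃ Fin m)
    (d : Fin K → ℕ) (G : Set (Fin K → Matrix ι ι ℝ))
    (hG : ∀ (S : Fin K → Matrix ι ι ℝ), (∀ l, (S l).IsSymm) → S ∈ closure G)
    (hB : ∀ S' ∈ G, Multiset.card (((∑ l, (X : ℝ[X]) ^ d l • (S' l).map C).det.roots.filter (fun t => 0 < t))) ≤ B)
    (S : Fin K → Matrix (Fin m) (Fin m) ℝ) (hS : ∀ l, (S l).IsSymm) :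
    ((∑ l, (X : ℝ[X]) ^ d l • (S l).map C).det.roots.toFinset.filter (fun t => 0 < t)).card ≤ B := by
  classical
  -- push the family forward along the reindexing homeomorphism
  let Φ : (Fin K → Matrix ι ι ℝ) → (Fin K → Matrix (Fin m) (Fin m) ℝ) := fun S l => Matrix.reindex e e (S l)
  refine card_posRoots_le_of_dense_mult d (Φ '' G) (fun T hT => ?_) (fun S' hS' => ?_) S hS
  · -- `T = Φ T₀` with `T₀` the pulled-back (still symmetric) family, and `Φ` is continuous
    set T₀ : Fin K → Matrix ι ι ℝ := fun l => Matrix.reindex e.symm e.symm (T l) with hT₀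
    have hT₀symm : ∀ l, (T₀ l).IsSymm := fun l => isSymm_reindex e.symm (hT l)
    have hΦT : Φ T₀ = T := by
      funext l
      ext i j
      simp [Φ, hT₀]
    have hmem : Φ T₀ ∈ closure (Φ '' G) :=
      image_closure_subset_closure_image (continuous_reindex_letters e) ⟨T₀, hG T₀ hT₀symm, rfl⟩
    rwa [hΦT] at hmem
  · obtain ⟨T, hT, rfl⟩ := hS'
    have hdet : (∑ l, (X : ℝ[X]) ^ d l • ((Φ T) l).map C).det = (∑ l, (X : ℝ[X]) ^ d l • (T l).map C).det :=
      det_pencil_reindex e d T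
    rw [hdet]
    exact hB T hT

/-- **Dense transfer, MULTIPLICITY currency, on any index type `ι ≃ Fin m`, all supports.** [folklore] -/
theorem posRootLawAt_of_dense_mult_reindex {B : ℕ} {ι : Type*} [Fintype ι] [DecidableEq ι] (e : ι ≃ Fin m)
    (G : (Fin K → ℕ) → Set (Fin K → Matrix ι ι ℝ))
    (hG : ∀ (d : Fin K → ℕ) (S : Fin K → Matrix ι ι ℝ), (∀ l, (S l).IsSymm) → S ∈ closure (G d))
    (hB : ∀ (d : Fin K → ℕ), ∀ S' ∈ G d,
      Multiset.card (((∑ l, (X : ℝ[X]) ^ d l • (S' l).map C).det.roots.filter (fun t => 0 < t))) ≤ B) :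
    PosRootLawAt m K B :=
  fun d S hS => card_posRoots_le_of_dense_mult_reindex e d (G d) (hG d) (hB d) S hS

/-! ## Support normal form: density is only needed on strictly increasing supports with `d 0 = 0` -/

/-- With no letters there is nothing to count: `PosRootLawAt m 0 B` for every `B`. -/
theorem posRootLawAt_zero_letters (B : ℕ) : PosRootLawAt m 0 B := by
  classical
  intro d S hS
  rw [SymmetroidDescartes.card_filter_roots_det_sum_fin_zero]
  exact Nat.zero_le _

/-- **Dense transfer, consumer form for the recursion** (multiplicity currency, any index type `ι ≃ Fin m`, density
and the bound asked ONLY on supports in normal form: `d` strictly increasing with `d 0 = 0` — tree: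
`Census.posRootLawAt_iff_strictMono`; repeated exponents merge and a common power of `X` factors off).  On supports
with repeated exponents a general-position class need NOT be dense (e.g. on a constant support every pencil whose
letter sum has a negative eigenvalue has a monomial spectral branch, hence an infinite osculation set), so this is the
form the line's density residue should take. [folklore] -/
theorem posRootLawAt_of_dense_mult_reindex_strictMono {B : ℕ} {ι : Type*} [Fintype ι] [DecidableEq ι]
    (e : ι ≃ Fin m) (G : (Fin (K + 1) → ℕ) → Set (Fin (K + 1) → Matrix ι ι ℝ))
    (hG : ∀ (d : Fin (K + 1) → ℕ), StrictMono d → d 0 = 0 →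
      ∀ (S : Fin (K + 1) → Matrix ι ι ℝ), (∀ l, (S l).IsSymm) → S ∈ closure (G d))
    (hB : ∀ (d : Fin (K + 1) → ℕ), StrictMono d → d 0 = 0 → ∀ S' ∈ G d,
      Multiset.card (((∑ l, (X : ℝ[X]) ^ d l • (S' l).map C).det.roots.filter (fun t => 0 < t))) ≤ B) :
    PosRootLawAt m (K + 1) B := by
  rw [Census.posRootLawAt_iff_strictMono]
  intro d hd h0 S hS
  exact card_posRoots_le_of_dense_mult_reindex e d (G d) (hG d hd h0) (hB d hd h0) S hS

/-- The same consumer form on `Fin m` itself (no reindexing). [folklore] -/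
theorem posRootLawAt_of_dense_mult_strictMono {B : ℕ} (G : (Fin (K + 1) → ℕ) → Set (Fin (K + 1) → Matrix (Fin m) (Fin m) ℝ))
    (hG : ∀ (d : Fin (K + 1) → ℕ), StrictMono d → d 0 = 0 →
      ∀ (S : Fin (K + 1) → Matrix (Fin m) (Fin m) ℝ), (∀ l, (S l).IsSymm) → S ∈ closure (G d))
    (hB : ∀ (d : Fin (K + 1) → ℕ), StrictMono d → d 0 = 0 → ∀ S' ∈ G d,
      Multiset.card (((∑ l, (X : ℝ[X]) ^ d l • (S' l).map C).det.roots.filter (fun t => 0 < t))) ≤ B) :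
    PosRootLawAt m (K + 1) B := by
  rw [Census.posRootLawAt_iff_strictMono]
  intro d hd h0 S hS
  exact card_posRoots_le_of_dense_mult d (G d) (hG d hd h0) (hB d hd h0) S hS

end Summit.ValiantsHypothesis.ValiantsHypothesis.Theorems.LacunarySymmetroidMatrixDescartes.DenseTransfer
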